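import Mathlib
import Literature.RingTheory.CohomologyAnnihilator.Localization
import HarnessLib

/-!
# Persistence of the cohomology annihilator under adjoining inverses

Crux `HomologicalConductor.Persistence` (stmt-ResolutionOfSingularities-16484), line `birth`,
registered stub `stub_inversionPersistence`.

For a field extension `K / k`, a `k`-subalgebra `B` of `K` and a set `T ⊆ B`, the subalgebra
`L = B[t⁻¹ | t ∈ T] = Algebra.adjoin k (↑B ∪ {t⁻¹ | t ∈ T})` contains `B`, and through the
inclusion `B ≤ L` it is a localisation of `B`: every element of `L` is `b * s⁻¹` with `b, s ∈ B`,
`s ≠ 0` and `s⁻¹ ∈ L` (induction on `Algebra.adjoin`; `s` is a finite product of nonzero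
elements of `T`, and `(0 : K)⁻¹ = 0` is harmless), such `s` are units of `L`, and injectivity of
`B → L → K` gives the kernel condition, so `IsLocalization U L` for `U` the preimage in `B` of
the units of `L`. Hence `L` is essentially of finite type over `k` when `B` is
(`Algebra.EssFiniteType.of_isLocalization`, `Algebra.EssFiniteType.comp`), and for noetherian
`B` Iyengar–Takahashi 2014, Lemma 2.10(1) `U⁻¹ ca(R) ⊆ ca(U⁻¹R)` (tree
`Literature.RingTheory.CohomologyAnnihilator.algebraMap_mem_cohomologyAnnihilator_of_isLocalization`)
shows that the image of `ca B` in `K` lies in the image of `ca L`.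
-/

-- single-problem summit: the doubled namespace component is forced
set_option linter.dupNamespace false

noncomputable section

namespace Summit.ResolutionOfSingularities.ResolutionOfSingularities.Theorems.HomologicalConductor.PersistenceInversion

open Literature.RingTheory.CohomologyAnnihilator

variable {k K : Type} [Field k] [Field K] [Algebra k K]

/-- If `B ≤ L` are `k`-subalgebras of the field `K` and every element of `L` is `b * s⁻¹` with
`b, s ∈ B`, `s ≠ 0`, `s⁻¹ ∈ L`, then `L`, as a `B`-algebra through the inclusion, is the
localisation of `B` at the preimage of the units of `L`. [folklore] -/
theorem isLocalization_of_forall_exists_eq_mul_inv (B L : Subalgebra k K) (hBL : B ≤ L)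
    (h : ∀ y ∈ L, ∃ b ∈ B, ∃ s ∈ B, s ≠ 0 ∧ s⁻¹ ∈ L ∧ y = b * s⁻¹) :
    @IsLocalization ↥B _
      ((IsUnit.submonoid ↥L).comap (Subalgebra.inclusion hBL).toRingHom)
      ↥L _ (Subalgebra.inclusion hBL).toRingHom.toAlgebra := by
  letI : Algebra ↥B ↥L := (Subalgebra.inclusion hBL).toRingHom.toAlgebra
  refine (isLocalization_iff _ _).mpr ⟨fun s => s.2, fun y => ?_, fun {a b} hab => ?_⟩
  · obtain ⟨a, ha, s, hs, hs0, hsL, hy⟩ := h y y.2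
    have hunit : IsUnit (algebraMap ↥B ↥L ⟨s, hs⟩) := by
      refine IsUnit.of_mul_eq_one ⟨s⁻¹, hsL⟩ (Subtype.ext ?_)
      exact mul_inv_cancel₀ hs0
    refine ⟨(⟨a, ha⟩, ⟨⟨s, hs⟩, hunit⟩), Subtype.ext ?_⟩
    change (y : K) * s = a
    rw [hy, inv_mul_cancel_right₀ hs0]
  · have hab' : (a : K) = b := congrArg (fun t : ↥L => (t : K)) hab
    exact ⟨1, by rw [Subtype.ext hab']⟩

/-- Under the hypotheses of `isLocalization_of_forall_exists_eq_mul_inv`, `L` is essentially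
of finite type over `k` when `B` is (a localisation is essentially of finite type, and the
property is transitive). [folklore] -/
theorem essFiniteType_of_forall_exists_eq_mul_inv (B L : Subalgebra k K) (hBL : B ≤ L)
    (h : ∀ y ∈ L, ∃ b ∈ B, ∃ s ∈ B, s ≠ 0 ∧ s⁻¹ ∈ L ∧ y = b * s⁻¹)
    (hB : Algebra.EssFiniteType k ↥B) : Algebra.EssFiniteType k ↥L := by
  letI : Algebra ↥B ↥L := (Subalgebra.inclusion hBL).toRingHom.toAlgebra
  haveI : IsScalarTower k ↥B ↥L := IsScalarTower.of_algebraMap_eq fun _ => rfl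
  haveI : IsLocalization ((IsUnit.submonoid ↥L).comap (algebraMap ↥B ↥L)) ↥L :=
    isLocalization_of_forall_exists_eq_mul_inv B L hBL h
  haveI : Algebra.EssFiniteType ↥B ↥L :=
    Algebra.EssFiniteType.of_isLocalization ↥L ((IsUnit.submonoid ↥L).comap (algebraMap ↥B ↥L))
  exact Algebra.EssFiniteType.comp k ↥B ↥L

/-- Under the hypotheses of `isLocalization_of_forall_exists_eq_mul_inv` and for noetherian
`B`, the image in `K` of the cohomology annihilator `ca B` lies in the image of `ca L`:
Iyengar–Takahashi, `U⁻¹ ca(R) ⊆ ca(U⁻¹R)`. [cite: IyengarTakahashi2014, Lemma 2.10(1)] -/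
theorem image_cohomologyAnnihilator_subset_of_forall_exists_eq_mul_inv (B L : Subalgebra k K)
    (hBL : B ≤ L) (h : ∀ y ∈ L, ∃ b ∈ B, ∃ s ∈ B, s ≠ 0 ∧ s⁻¹ ∈ L ∧ y = b * s⁻¹)
    (hB : IsNoetherianRing ↥B) :
    ((↑) : ↥B → K) '' (cohomologyAnnihilator ↥B : Set ↥B) ⊆
      ((↑) : ↥L → K) '' (cohomologyAnnihilator ↥L : Set ↥L) := by
  haveI := hB
  letI : Algebra ↥B ↥L := (Subalgebra.inclusion hBL).toRingHom.toAlgebra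
  haveI : IsLocalization ((IsUnit.submonoid ↥L).comap (algebraMap ↥B ↥L)) ↥L :=
    isLocalization_of_forall_exists_eq_mul_inv B L hBL h
  rintro _ ⟨x, hx, rfl⟩
  exact ⟨algebraMap ↥B ↥L x,
    algebraMap_mem_cohomologyAnnihilator_of_isLocalization
      (U := (IsUnit.submonoid ↥L).comap (algebraMap ↥B ↥L)) ↥L hx,
    rfl⟩

/-- `B ≤ B[t⁻¹ | t ∈ T]`. [folklore] -/
theorem le_adjoin_union_inv (B : Subalgebra k K) (T : Set K) :
    B ≤ Algebra.adjoin k ((B : Set K) ∪ {y : K | ∃ t ∈ T, y = t⁻¹}) :=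
  fun _ hx => Algebra.subset_adjoin (Or.inl hx)

/-- For `T ⊆ B`, every element of `L = B[t⁻¹ | t ∈ T]` is `b * s⁻¹` with `b, s ∈ B`, `s ≠ 0` and
`s⁻¹ ∈ L` (induction on `Algebra.adjoin`: generators, scalars, sums and products of such
fractions are again of this form, `K` being a field). [folklore] -/
theorem exists_eq_mul_inv_of_mem_adjoin_union_inv (B : Subalgebra k K) (T : Set K)
    (hT : T ⊆ ↑B) :
    ∀ y ∈ Algebra.adjoin k ((B : Set K) ∪ {y : K | ∃ t ∈ T, y = t⁻¹}),
      ∃ b ∈ B, ∃ s ∈ B, s ≠ 0 ∧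
        s⁻¹ ∈ Algebra.adjoin k ((B : Set K) ∪ {y : K | ∃ t ∈ T, y = t⁻¹}) ∧ y = b * s⁻¹ := by
  intro y hy
  have h1 : ∀ b ∈ B, ∃ b' ∈ B, ∃ s ∈ B, s ≠ 0 ∧
      s⁻¹ ∈ Algebra.adjoin k ((B : Set K) ∪ {y : K | ∃ t ∈ T, y = t⁻¹}) ∧ b = b' * s⁻¹ :=
    fun b hb => ⟨b, hb, 1, B.one_mem, one_ne_zero, by rw [inv_one]; exact Subalgebra.one_mem _,
      by rw [inv_one, mul_one]⟩
  induction hy using Algebra.adjoin_induction with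
  | mem x hx =>
    rcases hx with hxB | ⟨t, ht, rfl⟩
    · exact h1 x hxB
    · by_cases ht0 : t = 0
      · rw [ht0, inv_zero]
        exact h1 0 B.zero_mem
      · exact ⟨1, B.one_mem, t, hT ht, ht0, Algebra.subset_adjoin (Or.inr ⟨t, ht, rfl⟩),
          (one_mul _).symm⟩
  | algebraMap r => exact h1 _ (B.algebraMap_mem r)
  | add x y _ _ hx hy =>
    obtain ⟨b₁, hb₁, s₁, hs₁, hs₁0, hs₁L, rfl⟩ := hx
    obtain ⟨b₂, hb₂, s₂, hs₂, hs₂0, hs₂L, rfl⟩ := hy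
    refine ⟨b₁ * s₂ + b₂ * s₁, B.add_mem (B.mul_mem hb₁ hs₂) (B.mul_mem hb₂ hs₁), s₁ * s₂,
      B.mul_mem hs₁ hs₂, mul_ne_zero hs₁0 hs₂0, ?_, ?_⟩
    · rw [mul_inv]
      exact Subalgebra.mul_mem _ hs₁L hs₂L
    · field_simp
  | mul x y _ _ hx hy =>
    obtain ⟨b₁, hb₁, s₁, hs₁, hs₁0, hs₁L, rfl⟩ := hx
    obtain ⟨b₂, hb₂, s₂, hs₂, hs₂0, hs₂L, rfl⟩ := hy
    refine ⟨b₁ * b₂, B.mul_mem hb₁ hb₂, s₁ * s₂, B.mul_mem hs₁ hs₂, mul_ne_zero hs₁0 hs₂0, ?_, ?_⟩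
    · rw [mul_inv]
      exact Subalgebra.mul_mem _ hs₁L hs₂L
    · rw [mul_inv]
      ring

/-- **STUB `stub_inversionPersistence` (Iyengar–Takahashi 2014, Lemma 2.10(1)).** For a
`k`-subalgebra `B` of the field `K` and `T ⊆ B`, the subalgebra `B[t⁻¹ | t ∈ T]` is a
localisation of `B` (at the preimage of its units, generated by the nonzero elements of `T`);
hence it is essentially of finite type over `k` when `B` is, and, for `B` noetherian,
`ca B ⊆ ca (B[T⁻¹])` in `K`: `U⁻¹ ca(R) ⊆ ca(U⁻¹R)`, tree
`algebraMap_mem_cohomologyAnnihilator_of_isLocalization`.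
[cite: IyengarTakahashi2014, Lemma 2.10(1)] -/
theorem stub_inversionPersistence : ∀ (k K : Type) [Field k] [Field K] [Algebra k K]
    (B : Subalgebra k K) (T : Set K), T ⊆ ↑B →
    (Algebra.EssFiniteType k ↥B →
      Algebra.EssFiniteType k ↥(Algebra.adjoin k ((B : Set K) ∪ {y : K | ∃ t ∈ T, y = t⁻¹}))) ∧
    (IsNoetherianRing ↥B →
      ((↑) : ↥B → K) '' (Literature.RingTheory.CohomologyAnnihilator.cohomologyAnnihilator ↥B :
          Set ↥B) ⊆
        ((↑) : ↥(Algebra.adjoin k ((B : Set K) ∪ {y : K | ∃ t ∈ T, y = t⁻¹})) → K) ''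
          (Literature.RingTheory.CohomologyAnnihilator.cohomologyAnnihilator
            ↥(Algebra.adjoin k ((B : Set K) ∪ {y : K | ∃ t ∈ T, y = t⁻¹})) : Set _)) := by
  intro k K _ _ _ B T hT
  exact ⟨essFiniteType_of_forall_exists_eq_mul_inv B _ (le_adjoin_union_inv B T)
      (exists_eq_mul_inv_of_mem_adjoin_union_inv B T hT),
    image_cohomologyAnnihilator_subset_of_forall_exists_eq_mul_inv B _ (le_adjoin_union_inv B T)
      (exists_eq_mul_inv_of_mem_adjoin_union_inv B T hT)⟩

end Summit.ResolutionOfSingularities.ResolutionOfSingularities.Theorems.HomologicalConductor.PersistenceInversion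

end
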